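import Summits.ValiantsHypothesis.ValiantsHypothesis.Theorems.BarrierLeverAnchoredDoorHitsLowerPairsThinStepKill
import Summits.ValiantsHypothesis.ValiantsHypothesis.Theorems.BarrierLeverAnchoredDoorHitsLowerPairsDistinctAnchorsSpec

/-!
# Support item `AnchoredDoorHitsLowerPairs` (stmt-ValiantsHypothesis-22510), line `anchored_peeling`:
# CORE SPLITTING, part 1 — the core specialisation of the anchored witness: `κ(W) = Δ · K(W)`

Helper file (`--supports stmt-ValiantsHypothesis-22510`; cell valiant-natproofs, rung V4; prover seat val-np-p1 gen 30; memo
HOME/val-np-p1/g30/MEMO-char2-valnp1-g30.md §8). Bookkeeping `def`s `diagSet`, `OffCore`, `coreSpec`, `coreHom`, `coreVars`, `coreDelta` (part 2 `…CoreSplit` has `coreCls`, `offBlock` and the theorem). Closes NO item.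

THE DEVICE (`symbolicDet_ne_zero_of_coreSplit`). Fix a set `V` of `x`-vertices (the CORE) and an injective `τ : Fin h → Fin h` (its copy on the
`y`-side). Let `(u, w)` be any layout (`r` rows and columns) and `σ` a bijection of the indices MATCHING CORE PARTS: `w (σ i) ∩ τ(V) = τ(u i ∩ V)`.
Group the rows by their core part `u i ∩ V`; inside each group read the OFF-CORE layout `coeff (x^{u i ∖ V} y^{w (σ j) ∖ τV}) (symbolicWitness s h)`
(`offBlock`). If every such square block has nonzero determinant — each is, after re-enumeration, the symbolic minor of the off-core fibre pair
(`offBlock_det_eq_symbolicDet`), so ANY certificate of the line applies to it — then `symbolicDet s h r u w ≠ 0` (`s ≥ 1`).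
Special cases: joins with a cube (`…BlockProduct`: constant fibres), the permuted diagonal (all fibres `{∅}`), and «cube + junk against cube + junk′»
layouts whose junk fibres match core part by core part (deep × deep pairs outside the Hall regime of `…DistinctAnchors`).

PROOF. Specialise the parameters (`coreSpec`): the diagonal vertex anchors `({a} | {τ a})`, `a ∈ V`, get weight `1` and no tails; an anchor AVOIDING the
core keeps its weight and its tails off the core; every other weight and tail is killed. The specialised witness is `Δ · K W` with `Δ = ∏_{a∈V} (1 + x_a y_{τa})`
and `K` = killing the core variables (`ThinStep.killVars`; `map_coreSpec_symbolicWitness`), and `K W` has the same off-core layout coefficients as `W`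
(`ThinStep.coeff_killVars_of_disjoint`). Since `Δ` lives on the core variables and `K W` off them, the specialised layout entry is
`[w j ∩ τV = τ(u i ∩ V)] · coeff (x^{u i∖V} y^{w j∖τV}) W` (`coeff_mul_of_separated`, `coeff_coreDelta`); after the column permutation `σ` the matrix is block
diagonal by core class (`Matrix.BlockTriangular`), so its determinant is the product of the fibre determinants.

WHAT THIS IS NOT: a closure / transfer device; nothing on which fibre pairs are hit, on crux stmt-ValiantsHypothesis-14610, or on `VP ≠ VNP`.
-/

set_option linter.dupNamespace false

namespace Summit.ValiantsHypothesis.ValiantsHypothesis.Theorems.BarrierLever.AnchoredPeeling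

open Finset MvPolynomial
open Summit.ValiantsHypothesis.ValiantsHypothesis.Theorems.BarrierLever.BrickCalculus (pexpo pexpo_def pexpo_le_iff pexpo_sub
  pexpo_apply_castAdd pexpo_apply_natAdd)

noncomputable section

namespace CoreSplit

variable {h : ℕ}

/-! ## 1. The core specialisation of the parameters -/

/-- The diagonal vertex anchors `({a} | {τ a})`, `a ∈ V`. -/
def diagSet (V : Finset (Fin h)) (τ : Fin h → Fin h) : Finset (Finset (Fin h) × Finset (Fin h)) :=
  V.image fun a => (({a} : Finset (Fin h)), ({τ a} : Finset (Fin h)))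

/-- An anchor AVOIDS the core if its `x`-part misses `V` and its `y`-part misses `τ(V)`. -/
abbrev OffCore (V : Finset (Fin h)) (τ : Fin h → Fin h) (α : Finset (Fin h) × Finset (Fin h)) : Prop :=
  α.1 ∩ V = ∅ ∧ α.2 ∩ V.image τ = ∅

/-- **The core specialisation** `κ`: diagonal anchors ↦ weight `1`, no tails; off-core anchors keep their weight and their off-core tails; all else ↦ `0`. -/
def coreSpec (V : Finset (Fin h)) (τ : Fin h → Fin h) : Param h → MvPolynomial (Param h) ℂ :=
  Sum.elim (fun α => if α ∈ diagSet V τ then 1 else if OffCore V τ α then X (Sum.inl α) else 0)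
    (Sum.elim (fun q => if OffCore V τ q.1 ∧ q.2 ∉ V then X (Sum.inr (Sum.inl q)) else 0)
      (fun q => if OffCore V τ q.1 ∧ q.2 ∉ V.image τ then X (Sum.inr (Sum.inr q)) else 0))

/-- The core specialisation as a ring endomorphism of the parameter ring. -/
def coreHom (V : Finset (Fin h)) (τ : Fin h → Fin h) : MvPolynomial (Param h) ℂ →+* MvPolynomial (Param h) ℂ :=
  (bind₁ (coreSpec V τ)).toRingHom

/-- `coreHom` on a parameter variable. -/
theorem coreHom_X (V : Finset (Fin h)) (τ : Fin h → Fin h) (p : Param h) : coreHom V τ (X p) = coreSpec V τ p := by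
  rw [coreHom, AlgHom.toRingHom_eq_coe, RingHom.coe_coe, bind₁_X_right]

/-- The core variables: `x_a`, `a ∈ V`, and `y_d`, `d ∈ τ(V)`. -/
def coreVars (V : Finset (Fin h)) (τ : Fin h → Fin h) : Finset (Fin (h + h)) :=
  V.image (Fin.castAdd h) ∪ (V.image τ).image (Fin.natAdd h)

/-- Membership of an `x`-variable in the core variables. -/
theorem castAdd_mem_coreVars {V : Finset (Fin h)} {τ : Fin h → Fin h} {a : Fin h} :
    Fin.castAdd h a ∈ coreVars V τ ↔ a ∈ V := by
  rw [coreVars, Finset.mem_union, Finset.mem_image, Finset.mem_image]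
  constructor
  · rintro (⟨b, hb, hba⟩ | ⟨d, _, hd⟩)
    · rwa [← Fin.castAdd_injective _ _ hba]
    · exact absurd hd.symm (Summit.ValiantsHypothesis.ValiantsHypothesis.Theorems.BarrierLever.ProductStateSums.castAdd_ne_natAdd a d)
  · exact fun ha => Or.inl ⟨a, ha, rfl⟩

/-- Membership of a `y`-variable in the core variables. -/
theorem natAdd_mem_coreVars {V : Finset (Fin h)} {τ : Fin h → Fin h} {d : Fin h} :
    Fin.natAdd h d ∈ coreVars V τ ↔ d ∈ V.image τ := by
  rw [coreVars, Finset.mem_union, Finset.mem_image, Finset.mem_image]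
  constructor
  · rintro (⟨b, _, hb⟩ | ⟨d', hd', hdd⟩)
    · exact absurd hb (Summit.ValiantsHypothesis.ValiantsHypothesis.Theorems.BarrierLever.ProductStateSums.castAdd_ne_natAdd b d)
    · rwa [← Fin.natAdd_injective _ _ hdd]
  · exact fun hd => Or.inr ⟨d, hd, rfl⟩

/-! ## 2. The three kinds of anchor factors under `κ` and under killing the core variables -/

/-- A diagonal anchor factor specialises to `1 + x_a y_{τ a}`. -/
theorem map_coreHom_symbFactor_diag (V : Finset (Fin h)) (τ : Fin h → Fin h) {a : Fin h} (ha : a ∈ V) :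
    MvPolynomial.map (coreHom V τ) (symbFactor h (({a} : Finset (Fin h)), ({τ a} : Finset (Fin h)))) =
      1 + X (Fin.castAdd h a) * X (Fin.natAdd h (τ a)) := by
  have hmem : (({a} : Finset (Fin h)), ({τ a} : Finset (Fin h))) ∈ diagSet V τ := Finset.mem_image.mpr ⟨a, ha, rfl⟩
  have hnot : ¬ OffCore V τ (({a} : Finset (Fin h)), ({τ a} : Finset (Fin h))) := by
    intro hoff
    have := hoff.1
    rw [Finset.singleton_inter_of_mem ha] at this
    exact Finset.singleton_ne_empty a this
  rw [symbFactor, map_add, map_one, map_mul, map_mul, map_mul, map_mul, map_C, coreHom_X]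
  simp only [coreSpec, Sum.elim_inl, Sum.elim_inr, if_pos hmem, hnot, false_and, if_false, map_prod, map_add, map_one,
    map_mul, map_C, coreHom_X, map_X, C_0, zero_mul, add_zero, Finset.prod_const_one, mul_one, one_mul,
    Finset.prod_singleton, map_one]

/-- A factor of an anchor that is neither diagonal nor off-core specialises to `1`. -/
theorem map_coreHom_symbFactor_other (V : Finset (Fin h)) (τ : Fin h → Fin h) {α : Finset (Fin h) × Finset (Fin h)}
    (hdiag : α ∉ diagSet V τ) (hoff : ¬ OffCore V τ α) :
    MvPolynomial.map (coreHom V τ) (symbFactor h α) = 1 := by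
  rw [symbFactor, map_add, map_one, map_mul, map_mul, map_mul, map_mul, map_C, coreHom_X]
  simp only [coreSpec, Sum.elim_inl, if_neg hdiag, if_neg hoff, C_0, zero_mul, add_zero]

/-- An off-core anchor factor under `κ`: weight kept, tails off the core kept, tails into the core removed. -/
theorem map_coreHom_symbFactor_off (V : Finset (Fin h)) (τ : Fin h → Fin h) {α : Finset (Fin h) × Finset (Fin h)}
    (hdiag : α ∉ diagSet V τ) (hoff : OffCore V τ α) :
    MvPolynomial.map (coreHom V τ) (symbFactor h α) =
      1 + C (X (Sum.inl α)) * (∏ a ∈ α.1, X (Fin.castAdd h a)) * (∏ c ∈ α.2, X (Fin.natAdd h c)) *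
        (∏ b ∈ (univ \ α.1).filter (fun b => b ∉ V), (1 + C (X (Sum.inr (Sum.inl (α, b)))) * X (Fin.castAdd h b))) *
        (∏ d ∈ (univ \ α.2).filter (fun d => d ∉ V.image τ), (1 + C (X (Sum.inr (Sum.inr (α, d)))) * X (Fin.natAdd h d))) := by
  have hθ : coreSpec V τ (Sum.inl α) = X (Sum.inl α) := by
    simp only [coreSpec, Sum.elim_inl, if_neg hdiag, if_pos hoff]
  have hPX : MvPolynomial.map (coreHom V τ) (∏ a ∈ α.1, X (Fin.castAdd h a) :
      MvPolynomial (Fin (h + h)) (MvPolynomial (Param h) ℂ)) = ∏ a ∈ α.1, X (Fin.castAdd h a) := by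
    rw [map_prod]; exact Finset.prod_congr rfl (fun a _ => map_X _ _)
  have hPY : MvPolynomial.map (coreHom V τ) (∏ c ∈ α.2, X (Fin.natAdd h c) :
      MvPolynomial (Fin (h + h)) (MvPolynomial (Param h) ℂ)) = ∏ c ∈ α.2, X (Fin.natAdd h c) := by
    rw [map_prod]; exact Finset.prod_congr rfl (fun c _ => map_X _ _)
  have hTX : MvPolynomial.map (coreHom V τ)
      (∏ b ∈ univ \ α.1, (1 + C (X (Sum.inr (Sum.inl (α, b)))) * X (Fin.castAdd h b)) :
        MvPolynomial (Fin (h + h)) (MvPolynomial (Param h) ℂ)) =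
      ∏ b ∈ (univ \ α.1).filter (fun b => b ∉ V), (1 + C (X (Sum.inr (Sum.inl (α, b)))) * X (Fin.castAdd h b)) := by
    rw [map_prod, Finset.prod_filter]
    refine Finset.prod_congr rfl fun b _ => ?_
    rw [map_add, map_one, map_mul, map_C, coreHom_X, map_X]
    have hφ : coreSpec V τ (Sum.inr (Sum.inl (α, b))) = if b ∉ V then X (Sum.inr (Sum.inl (α, b))) else 0 := by
      simp only [coreSpec, Sum.elim_inr, Sum.elim_inl]
      by_cases hb : b ∈ V
      · rw [if_neg (fun hh => hh.2 hb), if_neg (not_not.mpr hb)]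
      · rw [if_pos ⟨hoff, hb⟩, if_pos hb]
    rw [hφ]
    split_ifs with hb
    · rw [C_0, zero_mul, add_zero]
    · rfl
  have hTY : MvPolynomial.map (coreHom V τ)
      (∏ d ∈ univ \ α.2, (1 + C (X (Sum.inr (Sum.inr (α, d)))) * X (Fin.natAdd h d)) :
        MvPolynomial (Fin (h + h)) (MvPolynomial (Param h) ℂ)) =
      ∏ d ∈ (univ \ α.2).filter (fun d => d ∉ V.image τ), (1 + C (X (Sum.inr (Sum.inr (α, d)))) * X (Fin.natAdd h d)) := by
    rw [map_prod, Finset.prod_filter]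
    refine Finset.prod_congr rfl fun d _ => ?_
    rw [map_add, map_one, map_mul, map_C, coreHom_X, map_X]
    have hψ : coreSpec V τ (Sum.inr (Sum.inr (α, d))) = if d ∉ V.image τ then X (Sum.inr (Sum.inr (α, d))) else 0 := by
      simp only [coreSpec, Sum.elim_inr]
      by_cases hd : d ∈ V.image τ
      · rw [if_neg (fun hh => hh.2 hd), if_neg (not_not.mpr hd)]
      · rw [if_pos ⟨hoff, hd⟩, if_pos hd]
    rw [hψ]
    split_ifs with hd
    · rw [C_0, zero_mul, add_zero]
    · rfl
  rw [symbFactor, map_add, map_one, map_mul, map_mul, map_mul, map_mul, map_C, coreHom_X, hθ, hPX, hPY, hTX, hTY]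

/-- Killing a `y`-variable of the anchor's `y`-part kills the factor. -/
theorem killVars_symbFactor_of_mem_y (W : Finset (Fin (h + h))) (α : Finset (Fin h) × Finset (Fin h)) {d : Fin h}
    (hd : d ∈ α.2) (hW : Fin.natAdd h d ∈ W) :
    ThinStep.killVars W (symbFactor h α) = 1 := by
  classical
  have hzero : ThinStep.killVars W (∏ c ∈ α.2, X (Fin.natAdd h c) :
      MvPolynomial (Fin (h + h)) (MvPolynomial (Param h) ℂ)) = 0 := by
    rw [map_prod]
    exact Finset.prod_eq_zero hd (by rw [ThinStep.killVars_X, if_pos hW])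
  rw [symbFactor, map_add, map_one, map_mul, map_mul, map_mul, map_mul, hzero]
  simp only [mul_zero, zero_mul, add_zero]

/-- Killing the core variables kills every factor of an anchor meeting the core. -/
theorem killVars_symbFactor_not_off (V : Finset (Fin h)) (τ : Fin h → Fin h) {α : Finset (Fin h) × Finset (Fin h)}
    (hoff : ¬ OffCore V τ α) : ThinStep.killVars (coreVars V τ) (symbFactor h α) = 1 := by
  classical
  rcases not_and_or.mp hoff with hA | hS
  · obtain ⟨a, ha⟩ := Finset.nonempty_iff_ne_empty.mpr hA
    rw [Finset.mem_inter] at ha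
    exact ThinStep.killVars_symbFactor_of_mem _ α ha.1 (castAdd_mem_coreVars.mpr ha.2)
  · obtain ⟨d, hd⟩ := Finset.nonempty_iff_ne_empty.mpr hS
    rw [Finset.mem_inter] at hd
    exact killVars_symbFactor_of_mem_y _ α hd.1 (natAdd_mem_coreVars.mpr hd.2)

/-- Killing the core variables on an off-core anchor factor: exactly the tails into the core disappear. -/
theorem killVars_symbFactor_off (V : Finset (Fin h)) (τ : Fin h → Fin h) {α : Finset (Fin h) × Finset (Fin h)}
    (hoff : OffCore V τ α) :
    ThinStep.killVars (coreVars V τ) (symbFactor h α) =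
      1 + C (X (Sum.inl α)) * (∏ a ∈ α.1, X (Fin.castAdd h a)) * (∏ c ∈ α.2, X (Fin.natAdd h c)) *
        (∏ b ∈ (univ \ α.1).filter (fun b => b ∉ V), (1 + C (X (Sum.inr (Sum.inl (α, b)))) * X (Fin.castAdd h b))) *
        (∏ d ∈ (univ \ α.2).filter (fun d => d ∉ V.image τ), (1 + C (X (Sum.inr (Sum.inr (α, d)))) * X (Fin.natAdd h d))) := by
  classical
  have hPX : ThinStep.killVars (coreVars V τ) (∏ a ∈ α.1, X (Fin.castAdd h a) :
      MvPolynomial (Fin (h + h)) (MvPolynomial (Param h) ℂ)) = ∏ a ∈ α.1, X (Fin.castAdd h a) := by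
    rw [map_prod]
    refine Finset.prod_congr rfl fun a ha => ?_
    rw [ThinStep.killVars_X, if_neg]
    rw [castAdd_mem_coreVars]
    intro haV
    have hmem : a ∈ α.1 ∩ V := Finset.mem_inter.mpr ⟨ha, haV⟩
    rw [hoff.1] at hmem
    exact Finset.notMem_empty a hmem
  have hPY : ThinStep.killVars (coreVars V τ) (∏ c ∈ α.2, X (Fin.natAdd h c) :
      MvPolynomial (Fin (h + h)) (MvPolynomial (Param h) ℂ)) = ∏ c ∈ α.2, X (Fin.natAdd h c) := by
    rw [map_prod]
    refine Finset.prod_congr rfl fun c hc => ?_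
    rw [ThinStep.killVars_X, if_neg]
    rw [natAdd_mem_coreVars]
    intro hcV
    have hmem : c ∈ α.2 ∩ V.image τ := Finset.mem_inter.mpr ⟨hc, hcV⟩
    rw [hoff.2] at hmem
    exact Finset.notMem_empty c hmem
  have hTX : ThinStep.killVars (coreVars V τ)
      (∏ b ∈ univ \ α.1, (1 + C (X (Sum.inr (Sum.inl (α, b)))) * X (Fin.castAdd h b)) :
        MvPolynomial (Fin (h + h)) (MvPolynomial (Param h) ℂ)) =
      ∏ b ∈ (univ \ α.1).filter (fun b => b ∉ V), (1 + C (X (Sum.inr (Sum.inl (α, b)))) * X (Fin.castAdd h b)) := by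
    rw [map_prod, Finset.prod_filter]
    refine Finset.prod_congr rfl fun b _ => ?_
    rw [map_add, map_one, map_mul, ThinStep.killVars_C, ThinStep.killVars_X]
    by_cases hb : b ∈ V
    · rw [if_pos (castAdd_mem_coreVars.mpr hb), if_neg (not_not.mpr hb), mul_zero, add_zero]
    · rw [if_neg (fun hm => hb (castAdd_mem_coreVars.mp hm)), if_pos hb]
  have hTY : ThinStep.killVars (coreVars V τ)
      (∏ d ∈ univ \ α.2, (1 + C (X (Sum.inr (Sum.inr (α, d)))) * X (Fin.natAdd h d)) :
        MvPolynomial (Fin (h + h)) (MvPolynomial (Param h) ℂ)) =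
      ∏ d ∈ (univ \ α.2).filter (fun d => d ∉ V.image τ), (1 + C (X (Sum.inr (Sum.inr (α, d)))) * X (Fin.natAdd h d)) := by
    rw [map_prod, Finset.prod_filter]
    refine Finset.prod_congr rfl fun d _ => ?_
    rw [map_add, map_one, map_mul, ThinStep.killVars_C, ThinStep.killVars_X]
    by_cases hd : d ∈ V.image τ
    · rw [if_pos (natAdd_mem_coreVars.mpr hd), if_neg (not_not.mpr hd), mul_zero, add_zero]
    · rw [if_neg (fun hm => hd (natAdd_mem_coreVars.mp hm)), if_pos hd]
  rw [symbFactor, map_add, map_one, map_mul, map_mul, map_mul, map_mul, ThinStep.killVars_C, hPX, hPY, hTX, hTY]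

/-! ## 3. The specialised witness is `Δ · (core variables killed)` -/

/-- The core diagonal `Δ = ∏_{a ∈ V} (1 + x_a y_{τ a})`. -/
def coreDelta (V : Finset (Fin h)) (τ : Fin h → Fin h) : MvPolynomial (Fin (h + h)) (MvPolynomial (Param h) ℂ) :=
  ∏ a ∈ V, (1 + X (Fin.castAdd h a) * X (Fin.natAdd h (τ a)))

/-- The diagonal anchors are anchors of every profile `s ≥ 1`. -/
theorem diagSet_subset_anchors {s : ℕ} (hs : 1 ≤ s) (V : Finset (Fin h)) (τ : Fin h → Fin h) : diagSet V τ ⊆ anchors s h := by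
  intro α hα
  obtain ⟨a, _, rfl⟩ := Finset.mem_image.mp hα
  simp only [anchors, Finset.mem_filter, Finset.mem_univ, true_and, Finset.card_singleton]
  omega

/-- A diagonal anchor meets the core. -/
theorem not_offCore_of_mem_diagSet {V : Finset (Fin h)} {τ : Fin h → Fin h} {α : Finset (Fin h) × Finset (Fin h)}
    (hα : α ∈ diagSet V τ) : ¬ OffCore V τ α := by
  obtain ⟨a, ha, rfl⟩ := Finset.mem_image.mp hα
  intro hoff
  have := hoff.1
  rw [Finset.singleton_inter_of_mem ha] at this
  exact Finset.singleton_ne_empty a this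

/-- **The specialised witness:** `κ(W) = Δ · K(W)`, `K` = killing the core variables. -/
theorem map_coreHom_symbolicWitness {s : ℕ} (hs : 1 ≤ s) (V : Finset (Fin h)) (τ : Fin h → Fin h) :
    MvPolynomial.map (coreHom V τ) (symbolicWitness s h) =
      coreDelta V τ * ThinStep.killVars (coreVars V τ) (symbolicWitness s h) := by
  classical
  have hfac : ∀ α ∈ anchors s h, MvPolynomial.map (coreHom V τ) (symbFactor h α) =
      if α ∈ diagSet V τ then 1 + (∏ a ∈ α.1, X (Fin.castAdd h a)) * (∏ c ∈ α.2, X (Fin.natAdd h c))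
      else ThinStep.killVars (coreVars V τ) (symbFactor h α) := by
    intro α _
    by_cases hd : α ∈ diagSet V τ
    · rw [if_pos hd]
      obtain ⟨a, ha, rfl⟩ := Finset.mem_image.mp hd
      rw [map_coreHom_symbFactor_diag V τ ha, Finset.prod_singleton, Finset.prod_singleton]
    · rw [if_neg hd]
      by_cases hoff : OffCore V τ α
      · rw [map_coreHom_symbFactor_off V τ hd hoff, killVars_symbFactor_off V τ hoff]
      · rw [map_coreHom_symbFactor_other V τ hd hoff, killVars_symbFactor_not_off V τ hoff]
  have hkill : ∀ α ∈ anchors s h, ThinStep.killVars (coreVars V τ) (symbFactor h α) =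
      if α ∈ diagSet V τ then 1 else ThinStep.killVars (coreVars V τ) (symbFactor h α) := by
    intro α _
    by_cases hd : α ∈ diagSet V τ
    · rw [if_pos hd, killVars_symbFactor_not_off V τ (not_offCore_of_mem_diagSet hd)]
    · rw [if_neg hd]
  rw [symbolicWitness_eq_prod, map_prod, map_prod, Finset.prod_congr rfl hfac, Finset.prod_congr rfl hkill,
    Finset.prod_ite, Finset.prod_ite, Finset.prod_const_one, one_mul]
  congr 1
  rw [Finset.filter_mem_eq_inter, Finset.inter_eq_right.mpr (diagSet_subset_anchors hs V τ), coreDelta, diagSet,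
    Finset.prod_image]
  · simp only [Finset.prod_singleton]
  · intro a _ b _ hab
    have := congrArg Prod.fst hab
    exact Finset.singleton_injective this

end CoreSplit

end

end Summit.ValiantsHypothesis.ValiantsHypothesis.Theorems.BarrierLever.AnchoredPeeling
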